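import Summits.CriticalPhenomena.PercolationContinuityZ3.Theorems.PercNearOneGluingNoHeavyPcintNawRandWindowCert
import HarnessLib

/-!
# PCINT lane, kernel window certificates in general dimension — computable geometry, bridge, coding

Cell `prim-pcint`, seat `prim-pcint-2` (gen 2); memo `run/shared/lean/prim/pcint/REDUCTIONS.md` §R2, §B2r.6, §B3r.7,
INTERVAL-PLAN §12–§14.  Does NOT build on p205010.  The kernel instances of the window certificates landed so far
(`…PcintWindowCertZ3K6*`, `…PcintSiteCertZ3K6*`, `…PcintBondCertZ3K6*`) hard-code `d = 3` (integer triples).  This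
file is the dimension-generic computable layer used by the instances for `d = 4, 5, 6`: positions of the extended
window as integer LISTS of length `d` (kernel-friendly for `decide`), the acceptance test `okc` (distinct sites),
visible chord count `cc`, NAW acceptance `okN`, gap count `gN` and corner flag `cN`, all proved SOUND for the
hypotheses of `le_criticalProb_zd_of_windowCert` / `le_criticalProb_zd_of_chordRandWindowCert` /
`le_siteCriticalProb_zd_of_nawRandWindowCert` (bridge `wordPos (wext u a) i = toSite (posL u a i)`,
`(zdGraph d).Adj (toSite x) (toSite y) ↔ adjL d x y`); the base-`2d` coding of windows with `decodeW_encW`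
(every window is decoded from its code, so a range check over `[0, (2d)^n)` covers all windows); the
hyperoctahedral normal-form code `codeOf` and table lookup `lookupV` for certificate vectors.
-/

namespace Summit.CriticalPhenomena.PercolationContinuityZ3.Theorems.Pcint

open Finset Literature.Probability.Percolation Literature.Probability.LatticeModels

namespace WinK

variable {d m : ℕ}

/-! ### Integer-list geometry of the extended window -/

/-- A step as an integer list of length `d`. [folklore] -/
def toL (d : ℕ) (a : Fin d × Bool) : List ℤ :=
  List.ofFn fun i : Fin d => if i = a.1 then (if a.2 then (1 : ℤ) else -1) else 0

/-- Componentwise addition of integer lists. [folklore] -/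
def addL (x y : List ℤ) : List ℤ := List.zipWith (· + ·) x y

/-- The origin as an integer list. [folklore] -/
def zeroL (d : ℕ) : List ℤ := List.replicate d 0

/-- Position after `i` steps of the extended window `wext u a` (junk-free for `i ≤ m + 2`). [folklore] -/
def posL (u : Fin (m + 1) → Fin d × Bool) (a : Fin d × Bool) : ℕ → List ℤ
  | 0 => zeroL d
  | i + 1 => addL (posL u a i) (if h : i < m + 2 then toL d (wext u a ⟨i, h⟩) else zeroL d)

/-- Computable adjacency test (`y = x ± e_i`, the form of `zdGraph_adj_iff`). [folklore] -/
def adjL (d : ℕ) (x y : List ℤ) : Bool :=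
  (List.finRange d).any fun i => decide (y = addL x (toL d (i, true))) || decide (x = addL y (toL d (i, true)))

/-- The `m + 3` sites of the extended window. [folklore] -/
def sites (u : Fin (m + 1) → Fin d × Bool) (a : Fin d × Bool) : List (List ℤ) := (List.range (m + 3)).map (posL u a)

/-- Acceptance test: the sites of the extended window are distinct. [folklore] -/
def okc (u : Fin (m + 1) → Fin d × Bool) (a : Fin d × Bool) : Bool := decide ((sites u a).Nodup)

/-- Visible chord count: window sites `P_0..P_m` adjacent to the new site `P_{m+2}`. [folklore] -/
def cc (u : Fin (m + 1) → Fin d × Bool) (a : Fin d × Bool) : ℕ :=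
  ((Finset.range (m + 1)).filter fun j => adjL d (posL u a j) (posL u a (m + 2)) = true).card

/-- NAW acceptance: distinct sites and no two non-consecutive sites adjacent. [folklore] -/
def okN (u : Fin (m + 1) → Fin d × Bool) (a : Fin d × Bool) : Bool :=
  okc u a && (List.range (m + 3)).all fun j => (List.range (j - 1)).all fun i => !adjL d (posL u a i) (posL u a j)

/-- Computable window gap sites: neighbours of the new site `P_{m+2}`, not window sites, adjacent to some `P_i`,
`i < m`. [folklore] -/
def gapSitesL (u : Fin (m + 1) → Fin d × Bool) (a : Fin d × Bool) : Finset (List ℤ) :=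
  ((univ : Finset (Fin d × Bool)).image fun e => addL (posL u a (m + 2)) (toL d e)).filter fun w =>
    w ∉ sites u a ∧ ((List.range m).any fun i => adjL d (posL u a i) w) = true

/-- Computable window gap count. [folklore] -/
def gN (u : Fin (m + 1) → Fin d × Bool) (a : Fin d × Bool) : ℕ := (gapSitesL u a).card

/-- The corner site `P_m + a`. [folklore] -/
def cornerL (u : Fin (m + 1) → Fin d × Bool) (a : Fin d × Bool) : List ℤ := addL (posL u a m) (toL d a)

/-- Computable corner flag: the corner site is not a window site and has no incidence `P_i`, `i < m`. [folklore] -/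
def cN (u : Fin (m + 1) → Fin d × Bool) (a : Fin d × Bool) : Bool :=
  decide (cornerL u a ∉ sites u a) && (List.range m).all fun i => !adjL d (posL u a i) (cornerL u a)

/-! ### Bridge to `wordPos` / `zdGraph` -/

/-- Integer list ↦ site of `ℤ^d` (coordinates beyond the list are `0`). [folklore] -/
def toSite (x : List ℤ) : Site d := fun i => x.getD i 0

/-- `getD` inside the list is `getElem`. [folklore] -/
private theorem getD_eq_getElem' {l : List ℤ} {i : ℕ} (h : i < l.length) : l.getD i 0 = l[i] := by
  rw [List.getD_eq_getElem?_getD, List.getElem?_eq_getElem h, Option.getD_some]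

/-- Length of a step list. [folklore] -/
@[simp] theorem length_toL (a : Fin d × Bool) : (toL d a).length = d := by simp [toL]

/-- Length of the origin list. [folklore] -/
@[simp] theorem length_zeroL : (zeroL d).length = d := by simp [zeroL]

/-- Length of a sum. [folklore] -/
theorem length_addL {x y : List ℤ} (hx : x.length = d) (hy : y.length = d) : (addL x y).length = d := by
  simp [addL, hx, hy]

/-- Length of a position list. [folklore] -/
theorem length_posL (u : Fin (m + 1) → Fin d × Bool) (a : Fin d × Bool) : ∀ i, (posL u a i).length = d
  | 0 => by simp [posL]
  | i + 1 => by
    rw [posL]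
    refine length_addL (length_posL u a i) ?_
    split_ifs <;> simp

/-- The origin list is the origin. [folklore] -/
theorem toSite_zeroL : toSite (zeroL d) = (0 : Site d) := by
  funext i
  have h1 : (i : ℕ) < (zeroL d).length := by rw [length_zeroL]; exact i.isLt
  simp only [toSite, Pi.zero_apply]
  rw [getD_eq_getElem' h1]
  simp [zeroL]

/-- `toSite` is additive on lists of length `d`. [folklore] -/
theorem toSite_addL {x y : List ℤ} (hx : x.length = d) (hy : y.length = d) :
    (toSite (addL x y) : Site d) = toSite x + toSite y := by
  funext i
  have h1 : (i : ℕ) < (addL x y).length := by rw [length_addL hx hy]; exact i.isLt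
  have h2 : (i : ℕ) < x.length := by rw [hx]; exact i.isLt
  have h3 : (i : ℕ) < y.length := by rw [hy]; exact i.isLt
  simp only [toSite, Pi.add_apply]
  rw [getD_eq_getElem' h1, getD_eq_getElem' h2, getD_eq_getElem' h3]
  simp [addL, List.getElem_zipWith]

/-- The step lists agree with `stepVec`. [folklore] -/
theorem toSite_toL (a : Fin d × Bool) : (toSite (toL d a) : Site d) = stepVec a := by
  funext i
  have h1 : (i : ℕ) < (toL d a).length := by rw [length_toL]; exact i.isLt
  simp only [toSite]
  rw [getD_eq_getElem' h1]
  obtain ⟨j, b⟩ := a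
  simp only [toL, List.getElem_ofFn, Fin.eta, stepVec]
  by_cases hij : i = j
  · subst hij; cases b <;> simp
  · cases b <;> simp [hij]

/-- `toSite` is injective on lists of length `d`. [folklore] -/
theorem toSite_inj {x y : List ℤ} (hx : x.length = d) (hy : y.length = d)
    (h : (toSite x : Site d) = toSite y) : x = y := by
  refine List.ext_getElem (hx.trans hy.symm) fun i h1 h2 => ?_
  have := congrFun h ⟨i, hx ▸ h1⟩
  simp only [toSite] at this
  rwa [getD_eq_getElem' h1, getD_eq_getElem' h2] at this

/-- **Bridge for positions**: `wordPos (wext u a) i = toSite (posL u a i)` for `i ≤ m + 2`. [folklore] -/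
theorem wordPos_eq_posL (u : Fin (m + 1) → Fin d × Bool) (a : Fin d × Bool) :
    ∀ {i : ℕ}, i ≤ m + 2 → wordPos (wext u a) i = (toSite (posL u a i) : Site d)
  | 0, _ => by rw [wordPos_zero, posL, toSite_zeroL]
  | i + 1, hi => by
    rw [wordPos_succ _ (by omega : i < m + 1 + 1), wordPos_eq_posL u a (by omega : i ≤ m + 2), posL,
      dif_pos (by omega), toSite_addL (length_posL u a i) (length_toL _), toSite_toL]

/-- The unit vector `e_i` is the step list of `(i, +)`. [folklore] -/
theorem single_eq_toSite (i : Fin d) : (Pi.single i 1 : Site d) = toSite (toL d (i, true)) := by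
  rw [toSite_toL]; simp [stepVec]

/-- **Bridge for adjacency** (lists of length `d`). [folklore] -/
theorem adj_iff_adjL {x y : List ℤ} (hx : x.length = d) (hy : y.length = d) :
    (zdGraph d).Adj (toSite x) (toSite y) ↔ adjL d x y = true := by
  rw [zdGraph_adj_iff, adjL, List.any_eq_true]
  constructor
  · rintro ⟨i, h | h⟩
    · refine ⟨i, List.mem_finRange i, ?_⟩
      rw [single_eq_toSite, ← toSite_addL hx (length_toL _)] at h
      have := toSite_inj hy (length_addL hx (length_toL _)) h
      simp [this]
    · refine ⟨i, List.mem_finRange i, ?_⟩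
      rw [single_eq_toSite, ← toSite_addL hy (length_toL _)] at h
      have := toSite_inj hx (length_addL hy (length_toL _)) h
      simp [this]
  · rintro ⟨i, -, h⟩
    simp only [Bool.or_eq_true, decide_eq_true_eq] at h
    rcases h with h | h
    · exact ⟨i, Or.inl (by rw [h, toSite_addL hx (length_toL _), single_eq_toSite])⟩
    · exact ⟨i, Or.inr (by rw [h, toSite_addL hy (length_toL _), single_eq_toSite])⟩

/-- Adjacency of window positions. [folklore] -/
theorem adj_posL_iff (u : Fin (m + 1) → Fin d × Bool) (a : Fin d × Bool) {i j : ℕ} (hi : i ≤ m + 2) (hj : j ≤ m + 2) :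
    (zdGraph d).Adj (wordPos (wext u a) i) (wordPos (wext u a) j) ↔ adjL d (posL u a i) (posL u a j) = true := by
  rw [wordPos_eq_posL u a hi, wordPos_eq_posL u a hj, adj_iff_adjL (length_posL u a i) (length_posL u a j)]

/-- A site of the list is a window site. [folklore] -/
theorem mem_sites {u : Fin (m + 1) → Fin d × Bool} {a : Fin d × Bool} {x : List ℤ} :
    x ∈ sites u a ↔ ∃ j ≤ m + 2, posL u a j = x := by
  simp only [sites, List.mem_map, List.mem_range]
  constructor
  · rintro ⟨j, hj, h⟩; exact ⟨j, by omega, h⟩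
  · rintro ⟨j, hj, h⟩; exact ⟨j, by omega, h⟩

/-! ### Soundness of the computable tests -/

/-- Self-avoiding extended windows are accepted. [folklore] -/
theorem hok (u : Fin (m + 1) → Fin d × Bool) (a : Fin d × Bool) (h : IsSAW (wext u a)) : okc u a = true := by
  rw [okc, decide_eq_true_eq, sites]
  refine List.Nodup.map_on (fun i hi j hj hij => ?_) List.nodup_range
  rw [List.mem_range] at hi hj
  apply h i j (by omega) (by omega)
  rw [wordPos_eq_posL u a (by omega), wordPos_eq_posL u a (by omega), hij]

/-- The computable chord count is the genuine window chord count. [folklore] -/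
theorem cc_eq (u : Fin (m + 1) → Fin d × Bool) (a : Fin d × Bool) : cc u a = winChordTrue u a := by
  unfold cc winChordTrue
  congr 1
  refine Finset.filter_congr fun j hj => ?_
  rw [Finset.mem_range] at hj
  rw [adj_posL_iff u a (by omega) (by omega : m + 1 + 1 ≤ m + 2)]

/-- Soundness of the chord count. [folklore] -/
theorem hc (u : Fin (m + 1) → Fin d × Bool) (a : Fin d × Bool) (_h : IsSAW (wext u a)) : cc u a ≤ winChordTrue u a :=
  (cc_eq u a).le

/-- Soundness of the NAW acceptance test. [folklore] -/
theorem hokN (u : Fin (m + 1) → Fin d × Bool) (a : Fin d × Bool) (h : IsSAW (wext u a))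
    (hch : chordEdges (wext u a) = ∅) : okN u a = true := by
  rw [okN, Bool.and_eq_true]
  refine ⟨hok u a h, ?_⟩
  rw [List.all_eq_true]
  intro j hj
  rw [List.mem_range] at hj
  rw [List.all_eq_true]
  intro i hi
  rw [List.mem_range] at hi
  rw [Bool.not_eq_true']
  by_contra hadj
  rw [Bool.not_eq_false, ← adj_posL_iff u a (by omega) (by omega)] at hadj
  have : s(wordPos (wext u a) i, wordPos (wext u a) j) ∈ chordEdges (wext u a) :=
    mem_chordEdges.2 ⟨i, j, by omega, by omega, hadj, rfl⟩
  rw [hch] at this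
  exact Finset.notMem_empty _ this

/-- Soundness of the gap count: every computable gap site is a genuine window gap site. [folklore] -/
theorem hgN (u : Fin (m + 1) → Fin d × Bool) (a : Fin d × Bool) : gN u a ≤ winGapTrue u a := by
  unfold gN winGapTrue
  refine Finset.card_le_card_of_injOn toSite (fun w hw => ?_) (fun x hx y hy hxy => ?_)
  · rw [mem_coe, gapSitesL, mem_filter, mem_image] at hw
    obtain ⟨⟨e, -, rfl⟩, hoff, hany⟩ := hw
    rw [List.any_eq_true] at hany
    obtain ⟨i, hi, hadj⟩ := hany
    rw [List.mem_range] at hi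
    rw [mem_coe, mem_winGapSet]
    have hlen : (addL (posL u a (m + 2)) (toL d e)).length = d := length_addL (length_posL u a _) (length_toL _)
    refine ⟨?_, fun j hj hje => ?_, i, by omega, ?_⟩
    · rw [wordPos_eq_posL u a le_rfl, zdGraph_adj_iff_stepVec]
      exact ⟨e, by rw [toSite_addL (length_posL u a _) (length_toL _), toSite_toL]⟩
    · rw [wordPos_eq_posL u a (by omega)] at hje
      exact hoff (mem_sites.2 ⟨j, by omega, toSite_inj (length_posL u a j) hlen hje⟩)
    · rw [wordPos_eq_posL u a (by omega), adj_iff_adjL (length_posL u a i) hlen]; exact hadj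
  · rw [mem_coe, gapSitesL, mem_filter, mem_image] at hx hy
    obtain ⟨⟨e, -, rfl⟩, -⟩ := hx
    obtain ⟨⟨e', -, rfl⟩, -⟩ := hy
    exact toSite_inj (length_addL (length_posL u a _) (length_toL _)) (length_addL (length_posL u a _) (length_toL _)) hxy

/-- Soundness of the corner flag. [folklore] -/
theorem hcN (u : Fin (m + 1) → Fin d × Bool) (a : Fin d × Bool) (hc : cN u a = true) : WinCornerTrue u a := by
  rw [cN, Bool.and_eq_true, decide_eq_true_eq, List.all_eq_true] at hc
  obtain ⟨hoff, hall⟩ := hc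
  have hlen : (cornerL u a).length = d := length_addL (length_posL u a _) (length_toL _)
  have hcorner : wordPos (wext u a) m + stepVec a = toSite (cornerL u a) := by
    rw [wordPos_eq_posL u a (by omega), cornerL, toSite_addL (length_posL u a _) (length_toL _), toSite_toL]
  refine ⟨fun j hj hje => ?_, fun i hi hadj => ?_⟩
  · rw [hcorner, wordPos_eq_posL u a (by omega)] at hje
    exact hoff (mem_sites.2 ⟨j, by omega, toSite_inj (length_posL u a j) hlen hje⟩)
  · rw [hcorner, wordPos_eq_posL u a (by omega), adj_iff_adjL (length_posL u a i) hlen] at hadj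
    have := hall i (List.mem_range.2 (by omega))
    rw [hadj] at this
    exact Bool.noConfusion this

/-- The chord count is at most `m + 1`. [folklore] -/
theorem cc_le (u : Fin (m + 1) → Fin d × Bool) (a : Fin d × Bool) : cc u a ≤ m + 1 :=
  (card_filter_le _ _).trans (by rw [card_range])

/-- The gap count is at most `2d`. [folklore] -/
theorem gN_le (u : Fin (m + 1) → Fin d × Bool) (a : Fin d × Bool) : gN u a ≤ 2 * d := by
  unfold gN gapSitesL
  refine (card_filter_le _ _).trans (card_image_le.trans ?_)
  rw [card_univ, Fintype.card_prod, Fintype.card_fin, Fintype.card_bool, mul_comm]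

/-! ### Base-`2d` coding of windows -/

/-- Code of a step: `2·axis + (0 for +, 1 for −)`. [folklore] -/
def encDir (a : Fin d × Bool) : ℕ := 2 * a.1.1 + (if a.2 then 0 else 1)

/-- Decoding of a step. [folklore] -/
def dirOf (d : ℕ) [NeZero d] (k : ℕ) : Fin d × Bool := (⟨k / 2 % d, Nat.mod_lt _ (NeZero.pos d)⟩, k % 2 == 0)

/-- Code of a window: digit `i` (base `2d`) is the code of step `i`. [folklore] -/
def encW : {n : ℕ} → (Fin n → Fin d × Bool) → ℕ
  | 0, _ => 0
  | _ + 1, u => encDir (u 0) + 2 * d * encW (Fin.tail u)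

/-- Decoding of a window from its code. [folklore] -/
def decodeW (d n : ℕ) [NeZero d] (c : ℕ) : Fin n → Fin d × Bool := fun i => dirOf d (c / (2 * d) ^ i.1 % (2 * d))

/-- Codes of steps are digits. [folklore] -/
theorem encDir_lt (a : Fin d × Bool) : encDir a < 2 * d := by
  have := a.1.isLt
  unfold encDir; split_ifs <;> omega

/-- Decoding inverts encoding of a step. [folklore] -/
theorem dirOf_encDir [NeZero d] (a : Fin d × Bool) : dirOf d (encDir a) = a := by
  obtain ⟨i, b⟩ := a
  have hi := i.isLt
  cases b
  · simp only [dirOf, encDir, Bool.false_eq_true, if_false]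
    refine Prod.ext (Fin.ext ?_) ?_
    · simp only; rw [show (2 * (i : ℕ) + 1) / 2 = i by omega, Nat.mod_eq_of_lt hi]
    · simp only; rw [show (2 * (i : ℕ) + 1) % 2 = 1 by omega]; rfl
  · simp only [dirOf, encDir, if_true, add_zero]
    refine Prod.ext (Fin.ext ?_) ?_
    · simp only; rw [show (2 * (i : ℕ)) / 2 = i by omega, Nat.mod_eq_of_lt hi]
    · simp only; rw [show (2 * (i : ℕ)) % 2 = 0 by omega]; rfl

/-- Codes of windows are below `(2d)^n`. [folklore] -/
theorem encW_lt : ∀ {n : ℕ} (u : Fin n → Fin d × Bool), encW u < (2 * d) ^ n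
  | 0, _ => by simp [encW]
  | n + 1, u => by
    have h1 := encDir_lt (u 0)
    have h2 := encW_lt (Fin.tail u)
    rw [encW, pow_succ]
    have : encDir (u 0) + 2 * d * encW (Fin.tail u) < 2 * d * (encW (Fin.tail u) + 1) := by
      rw [mul_add, mul_one, add_comm]; exact Nat.add_lt_add_left h1 _
    exact this.trans_le (by rw [mul_comm]; exact Nat.mul_le_mul_right _ h2)

/-- **Every window is the decoding of its code.** [folklore] -/
theorem decodeW_encW [NeZero d] : ∀ {n : ℕ} (u : Fin n → Fin d × Bool), decodeW d n (encW u) = u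
  | 0, u => by funext i; exact i.elim0
  | n + 1, u => by
    have hd : 0 < 2 * d := by have := NeZero.pos d; omega
    have h1 := encDir_lt (u 0)
    have hdiv : (encDir (u 0) + 2 * d * encW (Fin.tail u)) / (2 * d) = encW (Fin.tail u) := by
      rw [Nat.add_mul_div_left _ _ hd, Nat.div_eq_of_lt h1, zero_add]
    funext i
    refine Fin.cases ?_ (fun j => ?_) i
    · simp only [decodeW, encW, Fin.val_zero, pow_zero, Nat.div_one]
      rw [Nat.add_mul_mod_self_left, Nat.mod_eq_of_lt h1, dirOf_encDir]
    · have ih := congrFun (decodeW_encW (Fin.tail u)) j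
      simp only [decodeW, Fin.tail] at ih ⊢
      rw [Fin.val_succ, pow_succ', ← Nat.div_div_eq_div_mul, encW, hdiv]
      exact ih

/-- A Boolean check on a range of codes. [folklore] -/
def allRange (f : ℕ → Bool) (lo hi : ℕ) : Bool := (List.range' lo (hi - lo)).all f

/-- A checked range yields each of its codes. [folklore] -/
theorem of_allRange {f : ℕ → Bool} {lo hi : ℕ} (h : allRange f lo hi = true) {c : ℕ} (hlo : lo ≤ c) (hhi : c < hi) :
    f c = true := by
  rw [allRange, List.all_eq_true] at h
  exact h c (by rw [List.mem_range'_1]; omega)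

/-- Splitting a range check at a midpoint. [folklore] -/
theorem allRange_split {f : ℕ → Bool} {lo mid hi : ℕ} (h1 : allRange f lo mid = true) (h2 : allRange f mid hi = true) :
    allRange f lo hi = true := by
  rw [allRange, List.all_eq_true] at *
  intro c hc
  rw [List.mem_range'_1] at hc
  by_cases h : c < mid
  · exact h1 c (by rw [List.mem_range'_1]; omega)
  · exact h2 c (by rw [List.mem_range'_1]; omega)

/-- **A check on all codes `< (2d)^n` holds for (the code of) every window.** [folklore] -/
theorem forall_of_allRange {n : ℕ} {f : ℕ → Bool} (h : allRange f 0 ((2 * d) ^ n) = true)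
    (u : Fin n → Fin d × Bool) : f (encW u) = true :=
  of_allRange h (Nat.zero_le _) (encW_lt u)

/-! ### Hyperoctahedral normal-form code and certificate tables -/

/-- Digits of a step sequence in a frame: `2·(axis rank by first use) + (0 if the sign agrees with the first use)`.
[folklore] -/
def canonDigits : List (Fin d × Bool) → List (Fin d × ℕ × Bool) → ℕ → List ℕ
  | [], _, _ => []
  | a :: l, frame, nxt =>
    match frame.find? (fun e => e.1 = a.1) with
    | some e => (2 * e.2.1 + (if a.2 = e.2.2 then 0 else 1)) :: canonDigits l frame nxt
    | none => (2 * nxt) :: canonDigits l ((a.1, nxt, a.2) :: frame) (nxt + 1)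

/-- Base-`2d` code of the hyperoctahedral normal form of a window (axes relabelled by first use, first use positive),
matching the off-line enumeration. [folklore] -/
def codeOf {n : ℕ} (u : Fin n → Fin d × Bool) : ℕ :=
  ((canonDigits (List.ofFn u) [] 0).zipIdx.map fun q => q.1 * (2 * d) ^ q.2).sum

/-- Table lookup of a certificate value by normal-form code (default for codes not in the table). [folklore] -/
def lookupV {n : ℕ} (tbl : List (ℕ × ℕ)) (dflt : ℕ) (u : Fin n → Fin d × Bool) : ℕ :=
  ((tbl.find? fun e => e.1 = codeOf u).map fun e => e.2).getD dflt

/-- Bounds of a table lookup. [folklore] -/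
theorem lookupV_bounds {n : ℕ} {tbl : List (ℕ × ℕ)} {dflt lo hi : ℕ} (htbl : ∀ e ∈ tbl, lo ≤ e.2 ∧ e.2 ≤ hi)
    (hdflt : lo ≤ dflt ∧ dflt ≤ hi) (u : Fin n → Fin d × Bool) : lo ≤ lookupV tbl dflt u ∧ lookupV tbl dflt u ≤ hi := by
  unfold lookupV
  cases h : (tbl.find? fun e => e.1 = codeOf u) with
  | none => simpa using hdflt
  | some e =>
    simp only [Option.map_some, Option.getD_some]
    exact htbl e (List.mem_of_find?_eq_some h)

end WinK

end Summit.CriticalPhenomena.PercolationContinuityZ3.Theorems.Pcint
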